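import Literature.AnabelianGeometry.EtaleTheta.Discharge.Sec5PsiTransportDataOfBiKummerData
import Literature.AnabelianGeometry.EtaleTheta.Discharge.Sec5GaloisShadowOfBaseShadow

/-!
# [EtTh] Thm. 5.10 (ii) / Thm. 5.7 at the genuine §5 data over `B^temp(Π^tp_X)⁰`: ALL FIVE transport binders with ONE base shadow and ONE unit (pp. 328–329, 334 / PDF pp. 102–103, 108)

Mochizuki, *The étale theta function …*, Publ. RIMS **45** (2009), proof of Thm. 5.6/5.7 p.328–329 (PDF pp.102–103) ("`Ψ` induces a
1-compatible equivalence `Ψ^bs : D ⥲ D`, hence [cf. [SemiAnbd], Proposition 3.2] an outer automorphism of the tempered fundamental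
group … it follows from Propositions 2.4, 2.6 that `Ψ` preserves …"), proof of Thm. 5.10 (ii) p.334 (PDF p.108)
[cite: MochizukiEtTh2009, Thm 5.10 (ii) p.334 (PDF p.108)]; [FrdI] Thm. 3.4 (iii), (v) pp.62–63; [FrdI] Prop. 5.6 p.105.

PROOF-ONLY (no definitions, no new named facts).  abc-iut cell, layer L2 (prover abc-iut-w5-d245), capstone of the chain
p424854 / p427158 / p427494 / p428815 / p428959 / p434503 / p435768 for abc-iut-L2-d4's Thm. 5.7 wiring (`hdesc`: `∃ θ₁, StrvTransport
Ψ α₁ e₁ θ₁ ∧ (… .atLevel 1).HB.map θ₁ = (… .atLevel 1).HB`) and the K4 consolidation: at abc-iut-L2-t4's genuine §5 data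
`𝔉 := ThetaFrobenioid.ofConnectedTemperoidData …` (base `ConnectedPart (BTemp X.Pi) = B^temp(Π^tp_X)⁰`, `s^trv_N := strvOfBiKummerData`
CONSTRUCTED), for the model hypotheses (base of FSM-type, slim, `Φ` non-dilating, `C` not group-like), a section pair `(s^trv_N, φ)`,
a self-equivalence `Ψ` with identifications `α, β`, Prop. 5.3 (vi) at `A_N` (`e = 1` form) and Prop. 2.4 ("every topological
automorphism of `Π^tp_X` stabilises `Π^tp_Ÿ`", `ThetaEnvData` vocabulary):
`exists_unit_transports_hYdd_ofConnectedTemperoidData` — ∃ ONE base shadow `θ` (PRODUCED: abc-iut-L1-d4's `Ψ^bs = psiBase`, an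
equivalence) ∃ ONE unit `e ∈ O^×(A_N)` ∃ `D_c, D_p` with `hT ∧ hT′ ∧ hu ∧ hstrv ∧ hYdd` — the five transport binders of
`cyclotomicRigidityPreserved_ofBiKummerData` (p421202) for `θ₁ := θ_B := autBaseIsoAB⁻¹ ∘ θ ∘ autBaseIsoAB`.
Ingredients BY NAME: `exists_psiBaseTransportData_ofBiKummerData` (this file: p428815's producer returning also `Ψ^bs`, `eΨ`),
`exists_unit_transports_ofBiKummerData` (p427494), abc-iut-w5-d013's `exists_galoisShadow_of_baseShadow` ([SemiAnbd] Prop. 3.2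
shadow `γ`), `hYdd_ofBiKummerData_of_prop24` (p424854), abc-iut-L2-d4's `baseEquivalent_map_of_model`, `baseMap_strvOfBiKummerData`.
Nothing asserts that the §5 data exist for an actual curve; no side is taken on [IUTchIII] Cor. 3.12.
-/

noncomputable section

namespace Literature.AnabelianGeometry.EtaleTheta

open CategoryTheory Opposite Literature.AlgebraicGeometry.Frobenioids Literature.AnabelianGeometry.SemiGraphs
  Literature.AnabelianGeometry.SemiGraphs.GaloisObjects FrobenioidCyclotomicRigidity

namespace ThetaFrobenioid

universe u₀ v₀ u v w

section General

variable {K : Type u₀} [Field K]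
  {X : SemiGraphs.TemperedArithmeticGroup.{u₀} K} {D₀ : Type u₀} [Category.{v₀} D₀]
  {V : FrdIMonoidStub.{w}} {T₀ : RealifiedDivisorMonoids (D₀ := D₀) V} {D : Type u} [Category.{v} D]
  {VD : FrdICatStub.{u, v, w} D} {S : BiKummerSetting X T₀ D VD}
  {pullFrac : ∀ {A A' : S.C} (_ : A' ⟶ A), S.biratUnits A → S.biratUnits A'}
  {lv N : ℕ+} {θr : S.biratUnits S.Aodot} {Bl : S.C}
  {Pl : S.FractionPair θr Bl} {Rl : S.NthRoot θr Pl lv pullFrac}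
  (h : ModelFrobenioid.Hypotheses S.tf.divisorMonoid S.tf.ratFnFunctor) (R : S.NthRoot Rl.root Rl.pair N pullFrac)

include h in
/-- **[EtTh] Thm. 4.4 (i) data for the model, with `Ψ^bs` EXPOSED**: as `exists_psiTransportData_ofBiKummerData` (p428815) but
returning the equivalence `Ψ^bs := psiBase Ψ` ([FrdI] Thm. 3.4 (v), abc-iut-L1-d4) and its square `eΨ : Ψ ⋙ Base ≅ Base ⋙ Ψ^bs`
together with the base shadow `θ` at `A_N` (law `hθ`) and the Frobenius-transport clauses — so that consumers needing BOTH the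
shadow law and a compatible `Ψ^bs` (abc-iut-w5-d013's T56-L02 producers) are served by one call.
[cite: MochizukiEtTh2009, Thm 4.4 (i) p.320 (PDF p.94)] -/
theorem exists_psiBaseTransportData_ofBiKummerData (hD : IsOfFSMType D) (hslim : IsSlim D)
    (hnd : IsNonDilatingOn S.tf.divisorMonoid)
    (hN : ∃ A : S.C, ¬ (PreFrobenioidData.ofModel S.tf.divisorMonoid S.tf.ratFnFunctor S.tf.divBNatTrans).IsGroupLikeObj A)
    (Ψ : S.C ≌ S.C) (α : Ψ.functor.obj R.AN ≅ R.AN) :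
    ∃ (Ψbs : D ⥤ D) (_ : Ψbs.IsEquivalence)
      (_ : Ψ.functor ⋙ PreFrobenioid.baseFunctor S.F ≅ PreFrobenioid.baseFunctor S.F ⋙ Ψbs)
      (θ : Aut R.AN.base ≃* Aut R.AN.base) (ΨN : ℕ+ ≃* ℕ+),
      (∀ f : Aut R.AN, (PreFrobenioid.baseFunctor S.F).mapIso (α.symm ≪≫ Ψ.functor.mapIso f ≪≫ α) =
        θ ((PreFrobenioid.baseFunctor S.F).mapIso f)) ∧
      (∀ f : R.AN ⟶ R.AN, PreFrobenioid.degFr S.F (α.inv ≫ Ψ.functor.map f ≫ α.hom) = ΨN (PreFrobenioid.degFr S.F f)) ∧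
      (∀ f : R.AN ⟶ R.AN, PreFrobenioid.IsBaseIdentity S.F f →
        PreFrobenioid.IsBaseIdentity S.F (α.inv ≫ Ψ.functor.map f ≫ α.hom)) ∧
      (∀ f : R.AN ⟶ R.AN, PreFrobenioid.IsFrobeniusType S.F f →
        PreFrobenioid.IsFrobeniusType S.F (α.inv ≫ Ψ.functor.map f ≫ α.hom)) := by
  have hF : PreFrobenioid.IsFrobenioid S.F :=
    ModelFrobenioid.isFrobenioid (DivB := S.tf.divBNatTrans) h.isMonoidOn h.isDivisorial h.isMonoidOn_rat
      h.isGroupLike_rat h.isGraphConnected h.isTotallyEpimorphic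
  -- [FrdI] Thm. 3.4 (iii): the seven preservation clauses and `Ψ^{ℕ≥1}`, for `Ψ` and `Ψ⁻¹`
  have hq := ModelFrobenioid.data_isOfQuasiIsotropicType (DivB := S.tf.divBNatTrans) h
  have hnd' : (ModelFrobenioid.data S.tf.divisorMonoid S.tf.ratFnFunctor S.tf.divBNatTrans).IsNonDilatingOn :=
    (ModelFrobenioid.data_isNonDilatingOn_iff S.tf.divisorMonoid S.tf.ratFnFunctor S.tf.divBNatTrans).mpr hnd
  obtain ⟨hlist, ΨN, hN', -⟩ := FrdI.thm34iii_morphisms_of_isOfFSMType hF hF hq hq hD hD hnd' hnd' Ψ hN hN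
  obtain ⟨hlist', -⟩ := FrdI.thm34iii_morphisms_of_isOfFSMType hF hF hq hq hD hD hnd' hnd' Ψ.symm hN hN
  -- [FrdI] Thm. 3.4 (v), first sentence (slim base): `Ψ`, `Ψ⁻¹` preserve base-equivalent pairs; Thm. 3.4 (ii): pre-steps ↦ base-isos
  have hbeF : ∀ ⦃A B : S.C⦄ (φ ψ : A ⟶ B), PreFrobenioid.BaseEquivalent S.F φ ψ →
      PreFrobenioid.BaseEquivalent S.F (Ψ.functor.map φ) (Ψ.functor.map ψ) := fun A B φ ψ hφψ =>
    PreFrobenioid.baseEquivalent_map_of_isSlim hF hF Ψ hslim (fun X Y f hf => hlist.2.2.1 f hf) hφψ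
  have hbeF' : ∀ ⦃A B : S.C⦄ (φ ψ : A ⟶ B), PreFrobenioid.BaseEquivalent S.F φ ψ →
      PreFrobenioid.BaseEquivalent S.F (Ψ.inverse.map φ) (Ψ.inverse.map ψ) := fun A B φ ψ hφψ =>
    PreFrobenioid.baseEquivalent_map_of_isSlim hF hF Ψ.symm hslim (fun X Y f hf => hlist'.2.2.1 f hf) hφψ
  have hbi := isIso_base_map_of_isPreStep_model (DivB := S.tf.divBNatTrans) Ψ h hD
  have hbi' : ∀ ⦃Y A : S.C⦄ (a : Y ⟶ A), PreFrobenioid.IsPreStep S.F a →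
      IsIso (PreFrobenioid.Base S.F (Ψ.inverse.map a)) :=
    isIso_base_map_of_isPreStep_model (DivB := S.tf.divBNatTrans) Ψ.symm h hD
  haveI := PreFrobenioid.psiBase_isEquivalence hF hF Ψ hbi hbeF hbi' hbeF'
  obtain ⟨θ, hθ, hbi0⟩ := PreFrobenioid.exists_baseShadow_of_compatBase S.F Ψ
    (PreFrobenioid.psiBase hF Ψ.functor hbi hbeF) (PreFrobenioid.psiBaseSquare hF Ψ.functor hbi hbeF) α
  -- [FrdI] Thm. 3.4 (iii): Frobenius type and degrees through `α`
  have hftF : ∀ ⦃A B : S.C⦄ (g : A ⟶ B), PreFrobenioid.IsFrobeniusType S.F g →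
      PreFrobenioid.IsFrobeniusType S.F (Ψ.functor.map g) := fun A B g hg =>
    (PreFrobenioidData.ofFunctor_isFrobeniusType _ _).mp (hlist.1 g ((PreFrobenioidData.ofFunctor_isFrobeniusType _ _).mpr hg))
  have hNF : ∀ ⦃A B : S.C⦄ (g : A ⟶ B), PreFrobenioid.degFr S.F (Ψ.functor.map g) = ΨN (PreFrobenioid.degFr S.F g) := hN'
  exact ⟨PreFrobenioid.psiBase hF Ψ.functor hbi hbeF, inferInstance, PreFrobenioid.psiBaseSquare hF Ψ.functor hbi hbeF, θ, ΨN,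
    hθ, fun f => PreFrobenioid.degFr_conj_of_degFr_map S.F Ψ ΨN hNF α f, hbi0,
    fun f hf => PreFrobenioid.isFrobeniusType_conj_of_map S.F hF.isPreFrobenioid Ψ hftF α f hf⟩

end General

/-! ### The capstone at abc-iut-L2-t4's genuine §5 data `ofConnectedTemperoidData` -/

section ConnectedTemperoidData

variable {K : Type u₀} [Field K] {X : SemiGraphs.TemperedArithmeticGroup.{u₀} K} {D₀ : Type u₀} [Category.{v₀} D₀]
  {V : FrdIMonoidStub.{w}} {T₀ : RealifiedDivisorMonoids (D₀ := D₀) V}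
  {VD : FrdICatStub.{u₀ + 1, u₀, w} (ConnectedPart (BTemp X.Pi))}
  {tf : TemperedFrobenioid T₀ (ConnectedPart (BTemp X.Pi)) VD} {hZ : tf.monoidType = MonoidType.Z}
  {hP : ∀ A : (ConnectedPart (BTemp X.Pi))ᵒᵖ, IsPerfect (tf.Φ.carrier A)}
  {NH : Subgroup (Field.absoluteGaloisGroup K) → tf.category → ℕ+ → Prop} {A₀ : tf.category}
  {hA₀ : PreFrobenioid.IsFrobeniusTrivial tf.toElem A₀} {hA₀' : SemiGraphs.IsGaloisObj A₀.base.obj}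
  {lv N : ℕ+} {T : ThetaEnvData.{max u₀ w} N}
  {pullFrac : ∀ {A A' : (BiKummerSetting.mkOfConnectedTemperoid X tf hZ hP NH A₀ hA₀ hA₀').C} (_ : A' ⟶ A),
    (BiKummerSetting.mkOfConnectedTemperoid X tf hZ hP NH A₀ hA₀ hA₀').biratUnits A →
      (BiKummerSetting.mkOfConnectedTemperoid X tf hZ hP NH A₀ hA₀ hA₀').biratUnits A'}
  {θ : (BiKummerSetting.mkOfConnectedTemperoid X tf hZ hP NH A₀ hA₀ hA₀').biratUnits
    (BiKummerSetting.mkOfConnectedTemperoid X tf hZ hP NH A₀ hA₀ hA₀').Aodot}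
  {Bl : (BiKummerSetting.mkOfConnectedTemperoid X tf hZ hP NH A₀ hA₀ hA₀').C}
  {Pl : (BiKummerSetting.mkOfConnectedTemperoid X tf hZ hP NH A₀ hA₀ hA₀').FractionPair θ Bl}
  {Rl : (BiKummerSetting.mkOfConnectedTemperoid X tf hZ hP NH A₀ hA₀ hA₀').NthRoot θ Pl lv pullFrac}
  (h : ModelFrobenioid.Hypotheses tf.divisorMonoid tf.ratFnFunctor)
  (Q : FrobenioidTheta.ThetaSubquotientStub.{w} (ConnectedPart (BTemp X.Pi))) (odd_l : Odd (lv : ℕ))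
  (R : (BiKummerSetting.mkOfConnectedTemperoid X tf hZ hP NH A₀ hA₀ hA₀').NthRoot Rl.root Rl.pair N pullFrac)
  (ιX : T.PiX ≃ₜ* X.Pi) (K' : Type w) [Field K'] (constEmb : K'ˣ →* tf.biratUnitsModel R.BN)
  (constEmb_injective : Function.Injective constEmb)
  (hinvc : ∀ g : Aut R.AN.base,
    pull tf.divisorMonoid g.hom (ModelFrobenioid.div R.pair.num) = ModelFrobenioid.div R.pair.num)
  (hinvp : ∀ y : T.PiX, y ∈ T.PiYdd →
    pull tf.divisorMonoid ((BiKummerSetting.mkOfConnectedTemperoid X tf hZ hP NH A₀ hA₀ hA₀').galoisSurj R.AN.base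
      R.αData.isGalois (ιX y)).hom (ModelFrobenioid.div R.pair.den) = ModelFrobenioid.div R.pair.den)

/-- **Thm. 5.10 (ii) / Thm. 5.7 at the genuine §5 data: the FIVE transport binders `hT`, `hT′`, `hu`, `hstrv`, `hYdd` of
`cyclotomicRigidityPreserved_ofBiKummerData` with ONE produced base shadow `θ` and ONE unit `e`.**  Inputs: the model hypotheses
(`hD`, `hslim`, `hnd`, `hN`), a section pair `(s^trv_N, φ)` for the constructed `s^trv_N = strvOfBiKummerData` ([FrdI] Prop. 5.6:
"arising from a base-Frobenius pair of `A_N`"), `Ψ` with `α : Ψ(A_N) ≅ A_N`, `β : Ψ(B_N) ≅ B_N`, Prop. 5.3 (vi) at `A_N` for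
`s^⊓_N`, `s^⊔_N` (`e = 1` form), and Prop. 2.4 (`Π^tp_Ÿ` stable under every topological automorphism of `Π^tp_X`).
[cite: MochizukiEtTh2009, Thm 5.10 (ii) p.334 (PDF p.108)] -/
theorem exists_unit_transports_hYdd_ofConnectedTemperoidData (hD : IsOfFSMType (ConnectedPart (BTemp X.Pi)))
    (hslim : IsSlim (ConnectedPart (BTemp X.Pi))) (hnd : IsNonDilatingOn tf.divisorMonoid)
    (hN : ∃ A : (BiKummerSetting.mkOfConnectedTemperoid X tf hZ hP NH A₀ hA₀ hA₀').C,
      ¬ (PreFrobenioidData.ofModel tf.divisorMonoid tf.ratFnFunctor tf.divBNatTrans).IsGroupLikeObj A)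
    (φ : ℕ+ →* End R.AN)
    (hφ : ∀ n : ℕ+, PreFrobenioid.degFr (BiKummerSetting.mkOfConnectedTemperoid X tf hZ hP NH A₀ hA₀ hA₀').F (End.asHom (φ n)) = n ∧
      PreFrobenioid.IsBaseIdentity (BiKummerSetting.mkOfConnectedTemperoid X tf hZ hP NH A₀ hA₀ hA₀').F (End.asHom (φ n)) ∧
      PreFrobenioid.IsFrobeniusType (BiKummerSetting.mkOfConnectedTemperoid X tf hZ hP NH A₀ hA₀ hA₀').F (End.asHom (φ n)))
    (hc : ∀ (n : ℕ+) (g : Aut R.AN.base),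
      (strvOfBiKummerData h R g).hom ≫ End.asHom (φ n) = End.asHom (φ n) ≫ (strvOfBiKummerData h R g).hom)
    (Ψ : (BiKummerSetting.mkOfConnectedTemperoid X tf hZ hP NH A₀ hA₀ hA₀').C ≌
      (BiKummerSetting.mkOfConnectedTemperoid X tf hZ hP NH A₀ hA₀ hA₀').C)
    (α : Ψ.functor.obj (ofConnectedTemperoidData h Q odd_l R ιX K' constEmb constEmb_injective hinvc hinvp).AN ≅
      (ofConnectedTemperoidData h Q odd_l R ιX K' constEmb constEmb_injective hinvc hinvp).AN)
    (β : Ψ.functor.obj (ofConnectedTemperoidData h Q odd_l R ιX K' constEmb constEmb_injective hinvc hinvp).BN ≅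
      (ofConnectedTemperoidData h Q odd_l R ιX K' constEmb constEmb_injective hinvc hinvp).BN)
    (hdivcap₁ : (ofConnectedTemperoidData h Q odd_l R ιX K' constEmb constEmb_injective hinvc hinvp).pre.div
        (α.inv ≫ Ψ.functor.map (ofConnectedTemperoidData h Q odd_l R ιX K' constEmb constEmb_injective hinvc hinvp).sCap ≫ β.hom) =
      (ofConnectedTemperoidData h Q odd_l R ιX K' constEmb constEmb_injective hinvc hinvp).pre.div
        (ofConnectedTemperoidData h Q odd_l R ιX K' constEmb constEmb_injective hinvc hinvp).sCap)
    (hdivcup₁ : (ofConnectedTemperoidData h Q odd_l R ιX K' constEmb constEmb_injective hinvc hinvp).pre.div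
        (α.inv ≫ Ψ.functor.map (ofConnectedTemperoidData h Q odd_l R ιX K' constEmb constEmb_injective hinvc hinvp).sCup ≫ β.hom) =
      (ofConnectedTemperoidData h Q odd_l R ιX K' constEmb constEmb_injective hinvc hinvp).pre.div
        (ofConnectedTemperoidData h Q odd_l R ιX K' constEmb constEmb_injective hinvc hinvp).sCup)
    (hP24 : ∀ γ : T.PiX ≃ₜ* T.PiX, T.PiYdd.map γ.toMulEquiv.toMonoidHom = T.PiYdd) :
    ∃ θA : Aut R.AN.base ≃* Aut R.AN.base,
      ∃ e ∈ (ofConnectedTemperoidData h Q odd_l R ιX K' constEmb constEmb_injective hinvc hinvp).units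
          (ofConnectedTemperoidData h Q odd_l R ιX K' constEmb constEmb_injective hinvc hinvp).AN,
        ∃ Dc Dp : Aut (ofConnectedTemperoidData h Q odd_l R ιX K' constEmb constEmb_injective hinvc hinvp).BN,
          α.inv ≫ Ψ.functor.map (ofConnectedTemperoidData h Q odd_l R ιX K' constEmb constEmb_injective hinvc hinvp).sCap ≫
              (β ≪≫ Dc.symm).hom =
            e.hom ≫ (ofConnectedTemperoidData h Q odd_l R ιX K' constEmb constEmb_injective hinvc hinvp).sCap ≫
              (1 : Aut (ofConnectedTemperoidData h Q odd_l R ιX K' constEmb constEmb_injective hinvc hinvp).BN).hom ∧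
          α.inv ≫ Ψ.functor.map (ofConnectedTemperoidData h Q odd_l R ιX K' constEmb constEmb_injective hinvc hinvp).sCup ≫
              (β ≪≫ Dc.symm).hom =
            e.hom ≫ (ofConnectedTemperoidData h Q odd_l R ιX K' constEmb constEmb_injective hinvc hinvp).sCup ≫ Dp.hom ∧
          Dp ∈ (ofConnectedTemperoidData h Q odd_l R ιX K' constEmb constEmb_injective hinvc hinvp).units
            (ofConnectedTemperoidData h Q odd_l R ιX K' constEmb constEmb_injective hinvc hinvp).BN ∧
          (ofConnectedTemperoidData h Q odd_l R ιX K' constEmb constEmb_injective hinvc hinvp).StrvTransport Ψ α e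
            (((ofConnectedTemperoidData h Q odd_l R ιX K' constEmb constEmb_injective hinvc hinvp).autBaseIsoAB.symm.trans θA).trans
              (ofConnectedTemperoidData h Q odd_l R ιX K' constEmb constEmb_injective hinvc hinvp).autBaseIsoAB) ∧
          (ofConnectedTemperoidData h Q odd_l R ιX K' constEmb constEmb_injective hinvc hinvp).HB.map
              ((((ofConnectedTemperoidData h Q odd_l R ιX K' constEmb constEmb_injective hinvc hinvp).autBaseIsoAB.symm.trans
                  θA).trans
                (ofConnectedTemperoidData h Q odd_l R ιX K' constEmb constEmb_injective hinvc hinvp).autBaseIsoAB).toMonoidHom) =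
            (ofConnectedTemperoidData h Q odd_l R ιX K' constEmb constEmb_injective hinvc hinvp).HB := by
  -- the base shadow with its `Ψ^bs`, and the Frobenius transport of `Ψ` at `A_N` ([FrdI] Thm. 3.4 (iii)/(v))
  obtain ⟨Ψbs, hΨbs, eΨ, θA, ΨN, hθ, hdeg, hbi, hft⟩ :=
    exists_psiBaseTransportData_ofBiKummerData h R hD hslim hnd hN Ψ α
  -- "`Ψ` preserves base-equivalent pairs" ([FrdI] Thm. 3.4 (v), slim base)
  have hbe := baseEquivalent_map_of_model
    (𝔉 := ofConnectedTemperoidData h Q odd_l R ιX K' constEmb constEmb_injective hinvc hinvp) rfl h hD hslim hnd hN Ψ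
  -- `hT ∧ hT′ ∧ hu ∧ hstrv` with one unit (p427494) for the constructed section `s^trv_N` (a section: `baseMap_strvOfBiKummerData`)
  obtain ⟨e, he, Dc, Dp, hT, hT', hu, hstrv⟩ :=
    exists_unit_transports_ofBiKummerData h _ Q odd_l R ιX _ _ K' constEmb constEmb_injective _ _ hD Ψ hbe
      (baseMap_strvOfBiKummerData h R) φ hφ hc α β θA hθ ΨN hdeg hbi hft hdivcap₁ hdivcup₁
  -- `hYdd`: the shadow `γ` of `θA` ([SemiAnbd] Prop. 3.2, abc-iut-w5-d013) and Prop. 2.4 (p424854's reduction)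
  obtain ⟨γ, hγ⟩ := exists_galoisShadow_of_baseShadow h _ Q odd_l R ιX _ _ K' constEmb constEmb_injective _ _
    (fun _ hA => ⟨hA, fun _ => rfl⟩) (baseMap_strvOfBiKummerData h R) Ψ Ψbs eΨ α θA hθ
  have hYdd : (ofConnectedTemperoidData h Q odd_l R ιX K' constEmb constEmb_injective hinvc hinvp).HB.map
      ((((ofConnectedTemperoidData h Q odd_l R ιX K' constEmb constEmb_injective hinvc hinvp).autBaseIsoAB.symm.trans θA).trans
        (ofConnectedTemperoidData h Q odd_l R ιX K' constEmb constEmb_injective hinvc hinvp).autBaseIsoAB).toMonoidHom) =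
      (ofConnectedTemperoidData h Q odd_l R ιX K' constEmb constEmb_injective hinvc hinvp).HB :=
    hYdd_ofBiKummerData_of_prop24 h _ Q odd_l R ιX _ _ K' constEmb constEmb_injective _ _ _ γ (fun y => hγ y) (hP24 γ)
  exact ⟨θA, e, he, Dc, Dp, hT, hT', hu, hstrv, hYdd⟩

end ConnectedTemperoidData

end ThetaFrobenioid

end Literature.AnabelianGeometry.EtaleTheta

end
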